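import Summits.CriticalPhenomena.CardyFormulaZ2.Theses.DyadicBetaRigidity
import Summits.CriticalPhenomena.CardyFormulaZ2.Theorems.CardyMagicRigidityLoopsToCrossingsStubCyclicFlip
import Literature.Probability.RandomPlanarGeometry.ConformalRectangleProofs
import Literature.Probability.RandomPlanarGeometry.CrossRatioContinuity
import Literature.Probability.RandomPlanarGeometry.CardyFunctionIncBeta

/-!
# Continuity of a crossing law along uniformly close marked loops; the cyclic flip of the modulus

Support file for `DyadicBetaSuffices` (route DyadicBetaRigidity of `CardyFormulaZ2`, item
stmt-CriticalPhenomena-18184); the general-`F` forms of stubs D1 and D3 of line `oracle-sandwich`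
(crux `LoopsToCrossings`):

* `lawContinuity` — for `F` continuous on `(0, 1)` and a conformal rectangle `R` with uniformizing
  datum `(φ, x)`, every conformal rectangle whose boundary loop and marks are uniformly close to
  those of `R` has `F`-value close to `F(η_R)` for EVERY uniformizing datum (Radó's theorem,
  `ConformalRectangle.tendsto_crossRatio_of_tendsto_mark`);
* `exists_cyclicFlip_crossRatio` — the cyclically re-marked copy `R₂ = (Ω; P₁, P₂, P₃, P₀)` of
  `R` has conformal modulus `1 - η_R` (from `stub_cyclicFlip`, which records the Cardy values, by
  the injectivity of Cardy's function on `[0, 1]`).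

References: Ch. Pommerenke, *Boundary Behaviour of Conformal Maps* (1992), Thm. 2.11;
L. V. Ahlfors, *Complex Analysis* (1979), Ch. 3 §3.1.
-/

noncomputable section

namespace Summit.CriticalPhenomena.CardyFormulaZ2.Theorems

namespace DyadicLattice

open Set Metric Filter Topology
open Literature.Probability.RandomPlanarGeometry
open Summit.CriticalPhenomena.CardyFormulaZ2.Cruxes.LoopsToCrossings.OracleSandwich (stub_cyclicFlip)

/-- **Continuity of a crossing law along uniformly close marked loops** (general-`F` form of stub
D1 of line `oracle-sandwich`). For `F` continuous on `(0, 1)`, a conformal rectangle `R` with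
uniformizing datum `(φ, x)` and `τ > 0` there is `ε₀ > 0` such that every conformal rectangle `Q`
whose boundary loop is uniformly `ε₀`-close to that of `R` and whose marks are `ε₀`-close to those
of `R` satisfies `|F(η_Q) - F(η_R)| ≤ τ` for EVERY uniformizing datum of `Q`. Proof by
contradiction: offending `Q_n` converge to `R`, so their cross-ratios converge to `η_R ∈ (0, 1)`
(Radó, `ConformalRectangle.tendsto_crossRatio_of_tendsto_mark`), where `F` is continuous.
[cite: PommerenkeBBCM1992, Thm. 2.11 and Cor. 2.4] -/
theorem lawContinuity' {F : ℝ → ℝ} (hF : ContinuousOn F (Ioo 0 1)) (R : ConformalRectangle)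
    (φ : ConformalEquiv UpperHalfPlane.upperHalfPlaneSet R.carrier) (x : Fin 4 → ℝ)
    (hφ : R.IsUniformizing φ x) {τ : ℝ} (hτ : 0 < τ) :
    ∃ ε₀ : ℝ, 0 < ε₀ ∧ ∀ (Q : ConformalRectangle),
      (∀ u : ℝ, dist (Q.boundary u) (R.boundary u) ≤ ε₀) → (∀ i : Fin 4, |Q.mark i - R.mark i| ≤ ε₀) →
      ∀ (ψ : ConformalEquiv UpperHalfPlane.upperHalfPlaneSet Q.carrier) (y : Fin 4 → ℝ),
        Q.IsUniformizing ψ y → |F (crossRatio y) - F (crossRatio x)| ≤ τ := by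
  by_contra hcon
  push Not at hcon
  -- offending rectangles at closeness `1/(n+1)`
  have hseq : ∀ n : ℕ, ∃ Q : ConformalRectangle,
      (∀ u : ℝ, dist (Q.boundary u) (R.boundary u) ≤ 1 / ((n : ℝ) + 1)) ∧
      (∀ i : Fin 4, |Q.mark i - R.mark i| ≤ 1 / ((n : ℝ) + 1)) ∧
      ∃ (ψ : ConformalEquiv UpperHalfPlane.upperHalfPlaneSet Q.carrier) (y : Fin 4 → ℝ),
        Q.IsUniformizing ψ y ∧ τ < |F (crossRatio y) - F (crossRatio x)| := by
    intro n
    obtain ⟨Q, hQb, hQm, ψ, y, hψ, hbad⟩ := hcon _ (by positivity : (0 : ℝ) < 1 / ((n : ℝ) + 1))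
    exact ⟨Q, hQb, hQm, ψ, y, hψ, hbad⟩
  choose Q hQb hQm ψ y hψ hbad using hseq
  have hsmall : ∀ ε : ℝ, 0 < ε → ∀ᶠ n : ℕ in atTop, 1 / ((n : ℝ) + 1) < ε := fun ε hε ↦
    (tendsto_order.1 tendsto_one_div_add_atTop_nhds_zero_nat).2 ε hε
  -- the boundary loops converge uniformly and the marks converge
  have hJ : TendstoUniformly (fun n ↦ (Q n).boundary) R.boundary atTop := by
    rw [Metric.tendstoUniformly_iff]
    intro ε hε
    filter_upwards [hsmall ε hε] with n hn u
    rw [dist_comm]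
    exact (hQb n u).trans_lt hn
  have hm : ∀ i, Tendsto (fun n ↦ (Q n).mark i) atTop (𝓝 (R.mark i)) := fun i ↦ by
    rw [Metric.tendsto_nhds]
    intro ε hε
    filter_upwards [hsmall ε hε] with n hn
    rw [Real.dist_eq]
    exact (hQm n i).trans_lt hn
  -- hence the cross-ratios converge (Radó), and so do the `F`-values
  have hlim : Tendsto (fun n ↦ crossRatio (y n)) atTop (𝓝 (crossRatio x)) :=
    ConformalRectangle.tendsto_crossRatio_of_tendsto_mark hJ hm ψ y hψ φ x hφ
  have hFc : ContinuousAt F (crossRatio x) :=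
    hF.continuousAt
      (isOpen_Ioo.mem_nhds (ConformalRectangle.crossRatio_mem_Ioo_of_isUniformizing hφ))
  have hFlim := hFc.tendsto.comp hlim
  obtain ⟨n, hn⟩ := (Metric.tendsto_nhds.1 hFlim τ hτ).exists
  rw [Function.comp_apply, Real.dist_eq] at hn
  exact absurd hn (not_lt.2 (hbad n).le)

/-- **Continuity of a crossing law along uniformly close marked loops** (registered form of
`lawContinuity'`, stub of item stmt-CriticalPhenomena-18184). [cite: PommerenkeBBCM1992, Thm. 2.11 and Cor. 2.4] -/
theorem lawContinuity : ∀ {F : ℝ → ℝ}, ContinuousOn F (Set.Ioo 0 1) → ∀ (R : Literature.Probability.RandomPlanarGeometry.ConformalRectangle) (φ : Literature.Probability.RandomPlanarGeometry.ConformalEquiv UpperHalfPlane.upperHalfPlaneSet R.carrier) (x : Fin 4 → ℝ), R.IsUniformizing φ x → ∀ {τ : ℝ}, 0 < τ → ∃ ε₀ : ℝ, 0 < ε₀ ∧ ∀ (Q : Literature.Probability.RandomPlanarGeometry.ConformalRectangle), (∀ u : ℝ, dist (Q.boundary u) (R.boundary u) ≤ ε₀) → (∀ i : Fin 4, |Q.mark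 i - R.mark i| ≤ ε₀) → ∀ (ψ : Literature.Probability.RandomPlanarGeometry.ConformalEquiv UpperHalfPlane.upperHalfPlaneSet Q.carrier) (y : Fin 4 → ℝ), Q.IsUniformizing ψ y → |F (Literature.Probability.RandomPlanarGeometry.crossRatio y) - F (Literature.Probability.RandomPlanarGeometry.crossRatio x)| ≤ τ := by
  intro F hF R φ x hφ τ hτ
  exact lawContinuity' hF R φ x hφ hτ

/-- **Cyclic shift of the marking flips the conformal modulus** (general form of stub D3 of line
`oracle-sandwich`). Every conformal rectangle `R = (Ω; P₀, P₁, P₂, P₃)` has a re-parametrised,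
cyclically re-marked copy `R₂ = (Ω; P₁, P₂, P₃, P₀)` — same carrier, boundary loop
`u ↦ R.boundary (u + R.mark 1)`, marks `(0, m₂ - m₁, m₃ - m₁, m₀ + 1 - m₁)` — and for all
uniformizing data `η(R₂) = 1 - η(R)`. Obtained from `stub_cyclicFlip` (which records
`F(η(R₂)) = 1 - F(η(R)) = F(1 - η(R))` for Cardy's `F`) by the injectivity of Cardy's function on
`[0, 1]` (`strictMonoOn_cardyFunction_holds`). [cite: Ahlfors1979, Ch. 3 §3.1 and Ch. 6 §1.1] -/
theorem exists_cyclicFlip_crossRatio (R : ConformalRectangle) :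
    ∃ R₂ : ConformalRectangle, R₂.carrier = R.carrier ∧
      (∀ u : ℝ, R₂.boundary u = R.boundary (u + R.mark 1)) ∧
      (∀ i : Fin 4, R₂.mark i = ![0, R.mark 2 - R.mark 1, R.mark 3 - R.mark 1, R.mark 0 + 1 - R.mark 1] i) ∧
      ∀ (φ : ConformalEquiv UpperHalfPlane.upperHalfPlaneSet R.carrier) (x : Fin 4 → ℝ)
        (φ₂ : ConformalEquiv UpperHalfPlane.upperHalfPlaneSet R₂.carrier) (x₂ : Fin 4 → ℝ),
        R.IsUniformizing φ x → R₂.IsUniformizing φ₂ x₂ → crossRatio x₂ = 1 - crossRatio x := by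
  obtain ⟨R₂, hcar, hbd, hmk, hflip⟩ := stub_cyclicFlip R
  refine ⟨R₂, hcar, hbd, hmk, fun φ x φ₂ x₂ hφ hφ₂ ↦ ?_⟩
  have h := hflip φ x φ₂ x₂ hφ hφ₂
  have hη := ConformalRectangle.crossRatio_mem_Ioo_of_isUniformizing hφ
  have hη₂ := ConformalRectangle.crossRatio_mem_Ioo_of_isUniformizing hφ₂
  rw [← cardyFunction_one_sub_holds ⟨hη.1.le, hη.2.le⟩] at h
  exact strictMonoOn_cardyFunction_holds.injOn ⟨hη₂.1.le, hη₂.2.le⟩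
    ⟨by linarith [hη.2], by linarith [hη.1]⟩ h

end DyadicLattice

end Summit.CriticalPhenomena.CardyFormulaZ2.Theorems
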